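import Summits.ABC.IUTFork.Repair.RHHullThresholdExact
import Summits.ABC.IUTFork.Conditional.WRowHexLamSevenTriplesTwentySeven
import Summits.ABC.IUTFork.Conditional.WRowHexLamSevenTwentySevenRefutedCellsA
import HarnessLib

/-!
# R-W WINDOW numerics, HEX family `λ_k = 1/2 + 2/7^k` at `k = 27`: the REFUTED BAND's INTEGER CELLS, second half (part (R-cells); the first member's / lower piece lemmas are in `…RefutedCellsA.lean`, the W-lane shapes in `…RefutedBand.lean`) —
# top-label `HullCell` failures over the sharp class for `(ratPoint λ_27, l)` for EVERY prime `481 ≤ l ≤ 14533351453`, e-robustly and UNIFORMLY in `l`; glue: every prime `11 ≤ l ≤ 14533351453`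

PROOF-ONLY file (D-0012; 0 definitions, 0 `Prop` facts, no instance, no notation) of the abc-iut cell (W6 cone-prover seat
abc-iut-w6-d055, gen 16; row «W:HEX-AXIS-REST-3», `k = 27`, part (R); generator = abc-iut-C-cert-1 g9's gen_ref.py analytic piece plan run from HOME/staging/w6/w6-d055/g16/hexgen/build3.py; byte models C-cert-1's `k = 22 / 24` files p525962 · p526495 / p526937 · p527491, from the `k = 10` template p508090).
TAKES NO SIDE on [IUTchIII] Cor. 3.12 (S. Mochizuki, *Inter-universal Teichmüller theory III*, Cor. 3.12 p. 173–174; Step (xi-f) p. 184) or on any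
author; «refuted as typed» ≠ «refuted in print». BEFORE THIS FILE (BY NAME): at `k = 27` the K-line object FAILS at every prime `11 ≤ l ≤ 479` (abc-iut-W-neg-2's `HexRad.not_pilotKummerCompatHull_lamSeven_rad_eleven`, every `k ≥ 11`); no theorem names a level `l ≥ 481`.
THIS FILE: at the pole `p = 7` of the HEX27 triple `65712362363534280139547 + 65712362363534280139539 = 131424724727068560279086` (`v = v₇(abc) = 27`; prelude `WRowHexLamSevenTriplesTwentySeven`) abc-iut-W-neg-1's SHARP local-type
class (`WRow.localType_class_triple_sharp`, p498814 §1) leaves `A ∈ {5, 10}`; per member and turning-point piece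
(A = 5: a₀ = 4 on 481 ≤ l ≤ 2881; A = 5: a₀ = 5 on 2883 ≤ l ≤ 20167; A = 5: a₀ = 6 on 20169 ≤ l ≤ 141177; A = 5: a₀ = 7 on 141179 ≤ l ≤ 988251; A = 5: a₀ = 8 on 988253 ≤ l ≤ 6917761; A = 5: a₀ = 9 on 6917763 ≤ l ≤ 48424327; A = 5: a₀ = 10 on 48424329 ≤ l ≤ 338970297; A = 5: a₀ = 11 on 338970299 ≤ l ≤ 2372792091; A = 5: a₀ = 12 on 2372792093 ≤ l ≤ 14533351499; A = 10: a₀ = 4 on 481 ≤ l ≤ 1439; A = 10: a₀ = 5 on 1441 ≤ l ≤ 10083; A = 10: a₀ = 6 on 10085 ≤ l ≤ 70589; A = 10: a₀ = 7 on 70591 ≤ l ≤ 494125; A = 10: a₀ = 8 on 494127 ≤ l ≤ 3458879; A = 10: a₀ = 9 on 3458881 ≤ l ≤ 24212163; A = 10: a₀ = 10 on 24212165 ≤ l ≤ 169485149; A = 10: a₀ = 11 on 169485151 ≤ l ≤ 1186396045; A = 10: a₀ = 12 on 1186396047 ≤ l ≤ 8304772319; A = 10: a₀ = 13 on 8304772321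 ≤ l ≤ 14533351499) the top-label cell of R-H row 4's `HullCell` FAILS by a
floor-free downward parabola (`e·⌊X/e⌋ ≥ X − e + 1`, inner radius bounded by `6·r_in ≤ A·l + 6`), with no exact-floor literal level (the floor-free pieces reach the last refuted prime).
W-neg-1's three sockets (`Cor312LicenceTripleHullCellRefuteTameSharp` §2), transported to `ratPoint ((2 : ℚ)⁻¹ + 2/7^k)`, `k = 27`, give the three W-lane shapes
`WRow.not_licence_lamSeven_twentySeven_band` / `WRow.not_exists_qPinned_and_hull_lamSeven_twentySeven_band` / `GenuineK.not_pilotKummerCompatHull_chosen_lamSeven_twentySeven_band`,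
and the GLUE `GenuineK.not_pilotKummerCompatHull_chosen_lamSeven_twentySeven_le` (every prime `11 ≤ l ≤ 14533351453`). DESK (three desks agree: abc-iut-rw-num-lead g5's two-engine census HOME/plan/rescue/R-W/HEX-AXIS-CENSUS.tsv 23abd49ba74dfe76 — engine A (python exact) ≡ engine B (PARI, kit j277535) —
and this seat's generator arithmetic (abc-iut-C-cert-1 g9's analytic piece plan / slot-model check, HOME/staging/w6/w6-d055/g16/hexgen/desk3.py)): the exact top-label cell fails at every prime of the band and first holds at `l = 14533351507`; the
inhabited band from there is part (I) (`WRow.licence_lamSeven_twentySeven_all`), NOT claimed here. These levels are NOT rows of the R-W WINDOW-TABLE.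
HONEST SCOPE: OUR sharp containers and Dupuy–Hilado's typed (Ind1)/(Ind2); the per-label licence is a STRONGER-THAN-PRINT sufficient form of Step (xi-f);
admissibility / Szpiro-badness / (P6) of `(ratPoint λ_27, l)` and NON-EMPTINESS of the datum type are NOT claimed (a «∀ T» statement is vacuous if no datum
exists); nothing about the printed inequality, the number-level `Cor22.Cor312AtDatum` or any author's intended hull; typed ≠ proved; instantiated ≠ endorsed; no abc claim.
[cite: Mochizuki2012, IUTchI Ex. 3.2 (iv) p. 71; IUTchIII Cor. 3.12 Step (xi-d) p. 183, (xi-f) p. 184; IUTchIV Prop. 1.1 p. 9, Prop. 1.2 (i)(ii) p. 10, Thm. 1.10 p. 22, Cor. 2.2 (ii) proof (P5) p. 46]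
[cite: DupuyHilado2025, §3.3, §3.4, §4.9, §4.12] [cite: SilvermanATAEC1994, V.5 Thm. 5.3 and Cor. 5.4] [claim: Mochizuki2012, status: disputed] for every IUT sentence quoted.
-/

noncomputable section

open Set Function NumberField IsDedekindDomain

namespace Summit.ABC.IUTFork.Conditional

open Thm311 Thm311.Real Cor312 Cor312Vol Cor312Prov Literature.IUT.LogThetaLattice Literature.IUT.LogVolume
  Literature.IUT.HodgeTheaters Literature.IUT.LogVolume.ThetaData Literature.IUT.LogVolume.Cor22
open Literature.NumberTheory.NumberFields Literature.NumberTheory.GaloisRepresentations.Ultrametric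
open Literature.NumberTheory.DiophantineGeometry Literature.NumberTheory.DiophantineGeometry.GenEll Summit.ABC.ABC.Theorems
open Summit.ABC.IUTFork.Repair.RH.HullThresholdExact

/-! ## §1. The integer side at `p = 7`, `v = 27`: class `A ∈ {5, 10}`, top label -/

/-- Floor-free failure of the top-label cell, `k = 27`, member `A = 10` (`e = 10l`, `m = 270`), turning point `a₀ = 6` (`r_out = 117649 − 6·10l`),
every `5042 ≤ j ≤ 35294` (`l = 2j + 1`), for ANY inner radius with `6·r_in ≤ 10l + 6` (so for `⌊10l/6⌋ + 1`): `e·⌊X/e⌋ ≥ X − e + 1` and the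
margin is a downward parabola in `j` positive on the range. [folklore] -/
theorem RefBand.not_hullCell_hex27_A10_a6 {j rin : ℤ} (hlo : 5042 ≤ j) (hhi : j ≤ 35294) (hrin : 6 * rin ≤ 10 * (2 * j + 1) + 6) :
    ¬ HullCell (10 * (2 * j + 1)) 270 j rin (117649 - 6 * (10 * (2 * j + 1))) := by
  intro hc
  unfold HullCell at hc
  set e : ℤ := 10 * (2 * j + 1) with he
  have he0 : 0 < e := by rw [he]; omega
  set X : ℤ := j ^ 2 * 270 - j * (e - 1) - (j + 1) * rin with hX
  have hdiv : X - e < e * (X / e) := by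
    have h1 := Int.emod_add_mul_ediv X e
    have h2 := Int.emod_lt_of_pos X he0
    have h3 := Int.emod_nonneg X he0.ne'
    nlinarith [h1, h2, h3]
  have hk1 : 0 ≤ (35294 - j) * (j + 1) := mul_nonneg (by omega) (by omega)
  have hk2 : 0 ≤ (35294 - j) * (j - 5042) := mul_nonneg (by omega) (by omega)
  nlinarith [hdiv, hk1, hk2, hc, hrin, hX]

/-- Floor-free failure of the top-label cell, `k = 27`, member `A = 10` (`e = 10l`, `m = 270`), turning point `a₀ = 7` (`r_out = 823543 − 7·10l`),
every `35295 ≤ j ≤ 247062` (`l = 2j + 1`), for ANY inner radius with `6·r_in ≤ 10l + 6` (so for `⌊10l/6⌋ + 1`): `e·⌊X/e⌋ ≥ X − e + 1` and the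
margin is a downward parabola in `j` positive on the range. [folklore] -/
theorem RefBand.not_hullCell_hex27_A10_a7 {j rin : ℤ} (hlo : 35295 ≤ j) (hhi : j ≤ 247062) (hrin : 6 * rin ≤ 10 * (2 * j + 1) + 6) :
    ¬ HullCell (10 * (2 * j + 1)) 270 j rin (823543 - 7 * (10 * (2 * j + 1))) := by
  intro hc
  unfold HullCell at hc
  set e : ℤ := 10 * (2 * j + 1) with he
  have he0 : 0 < e := by rw [he]; omega
  set X : ℤ := j ^ 2 * 270 - j * (e - 1) - (j + 1) * rin with hX
  have hdiv : X - e < e * (X / e) := by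
    have h1 := Int.emod_add_mul_ediv X e
    have h2 := Int.emod_lt_of_pos X he0
    have h3 := Int.emod_nonneg X he0.ne'
    nlinarith [h1, h2, h3]
  have hk1 : 0 ≤ (247062 - j) * (j + 1) := mul_nonneg (by omega) (by omega)
  have hk2 : 0 ≤ (247062 - j) * (j - 35295) := mul_nonneg (by omega) (by omega)
  nlinarith [hdiv, hk1, hk2, hc, hrin, hX]

/-- Floor-free failure of the top-label cell, `k = 27`, member `A = 10` (`e = 10l`, `m = 270`), turning point `a₀ = 8` (`r_out = 5764801 − 8·10l`),
every `247063 ≤ j ≤ 1729439` (`l = 2j + 1`), for ANY inner radius with `6·r_in ≤ 10l + 6` (so for `⌊10l/6⌋ + 1`): `e·⌊X/e⌋ ≥ X − e + 1` and the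
margin is a downward parabola in `j` positive on the range. [folklore] -/
theorem RefBand.not_hullCell_hex27_A10_a8 {j rin : ℤ} (hlo : 247063 ≤ j) (hhi : j ≤ 1729439) (hrin : 6 * rin ≤ 10 * (2 * j + 1) + 6) :
    ¬ HullCell (10 * (2 * j + 1)) 270 j rin (5764801 - 8 * (10 * (2 * j + 1))) := by
  intro hc
  unfold HullCell at hc
  set e : ℤ := 10 * (2 * j + 1) with he
  have he0 : 0 < e := by rw [he]; omega
  set X : ℤ := j ^ 2 * 270 - j * (e - 1) - (j + 1) * rin with hX
  have hdiv : X - e < e * (X / e) := by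
    have h1 := Int.emod_add_mul_ediv X e
    have h2 := Int.emod_lt_of_pos X he0
    have h3 := Int.emod_nonneg X he0.ne'
    nlinarith [h1, h2, h3]
  have hk1 : 0 ≤ (1729439 - j) * (j + 1) := mul_nonneg (by omega) (by omega)
  have hk2 : 0 ≤ (1729439 - j) * (j - 247063) := mul_nonneg (by omega) (by omega)
  nlinarith [hdiv, hk1, hk2, hc, hrin, hX]

/-- Floor-free failure of the top-label cell, `k = 27`, member `A = 10` (`e = 10l`, `m = 270`), turning point `a₀ = 9` (`r_out = 40353607 − 9·10l`),
every `1729440 ≤ j ≤ 12106081` (`l = 2j + 1`), for ANY inner radius with `6·r_in ≤ 10l + 6` (so for `⌊10l/6⌋ + 1`): `e·⌊X/e⌋ ≥ X − e + 1` and the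
margin is a downward parabola in `j` positive on the range. [folklore] -/
theorem RefBand.not_hullCell_hex27_A10_a9 {j rin : ℤ} (hlo : 1729440 ≤ j) (hhi : j ≤ 12106081) (hrin : 6 * rin ≤ 10 * (2 * j + 1) + 6) :
    ¬ HullCell (10 * (2 * j + 1)) 270 j rin (40353607 - 9 * (10 * (2 * j + 1))) := by
  intro hc
  unfold HullCell at hc
  set e : ℤ := 10 * (2 * j + 1) with he
  have he0 : 0 < e := by rw [he]; omega
  set X : ℤ := j ^ 2 * 270 - j * (e - 1) - (j + 1) * rin with hX
  have hdiv : X - e < e * (X / e) := by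
    have h1 := Int.emod_add_mul_ediv X e
    have h2 := Int.emod_lt_of_pos X he0
    have h3 := Int.emod_nonneg X he0.ne'
    nlinarith [h1, h2, h3]
  have hk1 : 0 ≤ (12106081 - j) * (j + 1) := mul_nonneg (by omega) (by omega)
  have hk2 : 0 ≤ (12106081 - j) * (j - 1729440) := mul_nonneg (by omega) (by omega)
  nlinarith [hdiv, hk1, hk2, hc, hrin, hX]

/-- Floor-free failure of the top-label cell, `k = 27`, member `A = 10` (`e = 10l`, `m = 270`), turning point `a₀ = 10` (`r_out = 282475249 − 10·10l`),
every `12106082 ≤ j ≤ 84742574` (`l = 2j + 1`), for ANY inner radius with `6·r_in ≤ 10l + 6` (so for `⌊10l/6⌋ + 1`): `e·⌊X/e⌋ ≥ X − e + 1` and the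
margin is a downward parabola in `j` positive on the range. [folklore] -/
theorem RefBand.not_hullCell_hex27_A10_a10 {j rin : ℤ} (hlo : 12106082 ≤ j) (hhi : j ≤ 84742574) (hrin : 6 * rin ≤ 10 * (2 * j + 1) + 6) :
    ¬ HullCell (10 * (2 * j + 1)) 270 j rin (282475249 - 10 * (10 * (2 * j + 1))) := by
  intro hc
  unfold HullCell at hc
  set e : ℤ := 10 * (2 * j + 1) with he
  have he0 : 0 < e := by rw [he]; omega
  set X : ℤ := j ^ 2 * 270 - j * (e - 1) - (j + 1) * rin with hX
  have hdiv : X - e < e * (X / e) := by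
    have h1 := Int.emod_add_mul_ediv X e
    have h2 := Int.emod_lt_of_pos X he0
    have h3 := Int.emod_nonneg X he0.ne'
    nlinarith [h1, h2, h3]
  have hk1 : 0 ≤ (84742574 - j) * (j + 1) := mul_nonneg (by omega) (by omega)
  have hk2 : 0 ≤ (84742574 - j) * (j - 12106082) := mul_nonneg (by omega) (by omega)
  nlinarith [hdiv, hk1, hk2, hc, hrin, hX]

/-- Floor-free failure of the top-label cell, `k = 27`, member `A = 10` (`e = 10l`, `m = 270`), turning point `a₀ = 11` (`r_out = 1977326743 − 11·10l`),
every `84742575 ≤ j ≤ 593198022` (`l = 2j + 1`), for ANY inner radius with `6·r_in ≤ 10l + 6` (so for `⌊10l/6⌋ + 1`): `e·⌊X/e⌋ ≥ X − e + 1` and the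
margin is a downward parabola in `j` positive on the range. [folklore] -/
theorem RefBand.not_hullCell_hex27_A10_a11 {j rin : ℤ} (hlo : 84742575 ≤ j) (hhi : j ≤ 593198022) (hrin : 6 * rin ≤ 10 * (2 * j + 1) + 6) :
    ¬ HullCell (10 * (2 * j + 1)) 270 j rin (1977326743 - 11 * (10 * (2 * j + 1))) := by
  intro hc
  unfold HullCell at hc
  set e : ℤ := 10 * (2 * j + 1) with he
  have he0 : 0 < e := by rw [he]; omega
  set X : ℤ := j ^ 2 * 270 - j * (e - 1) - (j + 1) * rin with hX
  have hdiv : X - e < e * (X / e) := by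
    have h1 := Int.emod_add_mul_ediv X e
    have h2 := Int.emod_lt_of_pos X he0
    have h3 := Int.emod_nonneg X he0.ne'
    nlinarith [h1, h2, h3]
  have hk1 : 0 ≤ (593198022 - j) * (j + 1) := mul_nonneg (by omega) (by omega)
  have hk2 : 0 ≤ (593198022 - j) * (j - 84742575) := mul_nonneg (by omega) (by omega)
  nlinarith [hdiv, hk1, hk2, hc, hrin, hX]

/-- Floor-free failure of the top-label cell, `k = 27`, member `A = 10` (`e = 10l`, `m = 270`), turning point `a₀ = 12` (`r_out = 13841287201 − 12·10l`),
every `593198023 ≤ j ≤ 4152386159` (`l = 2j + 1`), for ANY inner radius with `6·r_in ≤ 10l + 6` (so for `⌊10l/6⌋ + 1`): `e·⌊X/e⌋ ≥ X − e + 1` and the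
margin is a downward parabola in `j` positive on the range. [folklore] -/
theorem RefBand.not_hullCell_hex27_A10_a12 {j rin : ℤ} (hlo : 593198023 ≤ j) (hhi : j ≤ 4152386159) (hrin : 6 * rin ≤ 10 * (2 * j + 1) + 6) :
    ¬ HullCell (10 * (2 * j + 1)) 270 j rin (13841287201 - 12 * (10 * (2 * j + 1))) := by
  intro hc
  unfold HullCell at hc
  set e : ℤ := 10 * (2 * j + 1) with he
  have he0 : 0 < e := by rw [he]; omega
  set X : ℤ := j ^ 2 * 270 - j * (e - 1) - (j + 1) * rin with hX
  have hdiv : X - e < e * (X / e) := by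
    have h1 := Int.emod_add_mul_ediv X e
    have h2 := Int.emod_lt_of_pos X he0
    have h3 := Int.emod_nonneg X he0.ne'
    nlinarith [h1, h2, h3]
  have hk1 : 0 ≤ (4152386159 - j) * (j + 1) := mul_nonneg (by omega) (by omega)
  have hk2 : 0 ≤ (4152386159 - j) * (j - 593198023) := mul_nonneg (by omega) (by omega)
  nlinarith [hdiv, hk1, hk2, hc, hrin, hX]

/-- Floor-free failure of the top-label cell, `k = 27`, member `A = 10` (`e = 10l`, `m = 270`), turning point `a₀ = 13` (`r_out = 96889010407 − 13·10l`),
every `4152386160 ≤ j ≤ 7266675749` (`l = 2j + 1`), for ANY inner radius with `6·r_in ≤ 10l + 6` (so for `⌊10l/6⌋ + 1`): `e·⌊X/e⌋ ≥ X − e + 1` and the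
margin is a downward parabola in `j` positive on the range. [folklore] -/
theorem RefBand.not_hullCell_hex27_A10_a13 {j rin : ℤ} (hlo : 4152386160 ≤ j) (hhi : j ≤ 7266675749) (hrin : 6 * rin ≤ 10 * (2 * j + 1) + 6) :
    ¬ HullCell (10 * (2 * j + 1)) 270 j rin (96889010407 - 13 * (10 * (2 * j + 1))) := by
  intro hc
  unfold HullCell at hc
  set e : ℤ := 10 * (2 * j + 1) with he
  have he0 : 0 < e := by rw [he]; omega
  set X : ℤ := j ^ 2 * 270 - j * (e - 1) - (j + 1) * rin with hX
  have hdiv : X - e < e * (X / e) := by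
    have h1 := Int.emod_add_mul_ediv X e
    have h2 := Int.emod_lt_of_pos X he0
    have h3 := Int.emod_nonneg X he0.ne'
    nlinarith [h1, h2, h3]
  have hk1 : 0 ≤ (7266675749 - j) * (j + 1) := mul_nonneg (by omega) (by omega)
  have hk2 : 0 ≤ (7266675749 - j) * (j - 4152386160) := mul_nonneg (by omega) (by omega)
  nlinarith [hdiv, hk1, hk2, hc, hrin, hX]

/-- **The engine's `hcell` for the HEX27 triple at `p = 7` (`v = 27`), odd `481 ≤ l ≤ 14533351499`, top label.** The sharp clauses force
`A ∈ {5, 10}`; per member and turning-point piece the cell fails by the floor-free lemmas above, at the literal levels by the exact floor. [folklore] -/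
theorem RefBand.cells_hex27_band {l : ℕ} (hlo : 481 ≤ l) (hhi : l ≤ 14533351499) (hodd : Odd l) {i : ℕ} (hi : i + 1 = (l - 1) / 2)
    (A : ℕ) (hA30 : A ∣ 30) (hA15 : 15 ∣ A * 27) (hAev : Even 27 → A ∣ 15) (hA3 : 3 ∣ 27 → A ∣ 10) (hA5 : 5 ∣ 27 → A ∣ 6) :
    ∃ a₀ : ℕ, (∀ s : ℕ, s < a₀ → (1 : ℤ) * ((7 : ℕ) : ℤ) ^ s * (((7 : ℕ) : ℤ) - 1) < ((A * l : ℕ) : ℤ)) ∧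
      ((A * l : ℕ) : ℤ) ≤ 1 * ((7 : ℕ) : ℤ) ^ a₀ * (((7 : ℕ) : ℤ) - 1) ∧
      ¬ HullCell ((A * l : ℕ) : ℤ) ((A * 27 : ℕ) : ℤ) ((i : ℤ) + 1) (((A * l) / ((7 : ℕ) - 1) + 1 : ℕ) : ℤ)
        (((7 : ℕ) : ℤ) ^ a₀ - (a₀ : ℤ) * ((A * l : ℕ) : ℤ)) := by
  have h10 : A ∣ 10 := hA3 (by decide)
  have hAg : A ∣ 10 := by
    exact h10
  have hdA : 5 ∣ A := by
    have h' : 5 ∣ A * 27 := Nat.dvd_trans (by norm_num) hA15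
    exact (Nat.Coprime.dvd_of_dvd_mul_right (by norm_num : Nat.Coprime 5 27) h')
  have hA : A = 5 ∨ A = 10 := by
    have h1 : A ≤ 10 := Nat.le_of_dvd (by norm_num) hAg
    have h2 : 0 < A := Nat.pos_of_dvd_of_pos hAg (by norm_num)
    interval_cases A <;> omega
  obtain ⟨j, hj⟩ := hodd
  have hij : (i : ℤ) + 1 = (j : ℤ) := by
    have : i + 1 = j := by omega
    exact_mod_cast this
  rcases hA with rfl | rfl
  · have hrin : (6 : ℤ) * (((((5 * l) / ((7 : ℕ) - 1) + 1 : ℕ) : ℤ))) ≤ 5 * (2 * (j : ℤ) + 1) + 6 := by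
      have h0 : ((7 : ℕ) - 1) * ((5 * l) / ((7 : ℕ) - 1)) ≤ 5 * l := Nat.mul_div_le _ _
      have h1 : (6 : ℤ) * ((((5 * l) / ((7 : ℕ) - 1) : ℕ) : ℤ)) ≤ ((5 * l : ℕ) : ℤ) := by exact_mod_cast h0
      push_cast at h1 ⊢; omega
    have he : ((5 * l : ℕ) : ℤ) = 5 * (2 * (j : ℤ) + 1) := by push_cast; omega
    have hm : ((5 * 27 : ℕ) : ℤ) = 135 := by norm_num
    by_cases hp0 : 481 ≤ l ∧ l ≤ 2881
    · refine ⟨4, fun s hs => ?_, ?_, ?_⟩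
      · interval_cases s <;> norm_num <;> omega
      · norm_num; omega
      · have hro : (((7 : ℕ) : ℤ) ^ 4 - ((4 : ℕ) : ℤ) * ((5 * l : ℕ) : ℤ)) = 2401 - 4 * (5 * (2 * (j : ℤ) + 1)) := by
          push_cast; omega
        rw [hro, hij, he, hm]
        exact RefBand.not_hullCell_hex27_A5_a4 (by omega) (by omega) hrin
    by_cases hp1 : 2883 ≤ l ∧ l ≤ 20167
    · refine ⟨5, fun s hs => ?_, ?_, ?_⟩
      · interval_cases s <;> norm_num <;> omega
      · norm_num; omega
      · have hro : (((7 : ℕ) : ℤ) ^ 5 - ((5 : ℕ) : ℤ) * ((5 * l : ℕ) : ℤ)) = 16807 - 5 * (5 * (2 * (j : ℤ) + 1)) := by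
          push_cast; omega
        rw [hro, hij, he, hm]
        exact RefBand.not_hullCell_hex27_A5_a5 (by omega) (by omega) hrin
    by_cases hp2 : 20169 ≤ l ∧ l ≤ 141177
    · refine ⟨6, fun s hs => ?_, ?_, ?_⟩
      · interval_cases s <;> norm_num <;> omega
      · norm_num; omega
      · have hro : (((7 : ℕ) : ℤ) ^ 6 - ((6 : ℕ) : ℤ) * ((5 * l : ℕ) : ℤ)) = 117649 - 6 * (5 * (2 * (j : ℤ) + 1)) := by
          push_cast; omega
        rw [hro, hij, he, hm]
        exact RefBand.not_hullCell_hex27_A5_a6 (by omega) (by omega) hrin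
    by_cases hp3 : 141179 ≤ l ∧ l ≤ 988251
    · refine ⟨7, fun s hs => ?_, ?_, ?_⟩
      · interval_cases s <;> norm_num <;> omega
      · norm_num; omega
      · have hro : (((7 : ℕ) : ℤ) ^ 7 - ((7 : ℕ) : ℤ) * ((5 * l : ℕ) : ℤ)) = 823543 - 7 * (5 * (2 * (j : ℤ) + 1)) := by
          push_cast; omega
        rw [hro, hij, he, hm]
        exact RefBand.not_hullCell_hex27_A5_a7 (by omega) (by omega) hrin
    by_cases hp4 : 988253 ≤ l ∧ l ≤ 6917761
    · refine ⟨8, fun s hs => ?_, ?_, ?_⟩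
      · interval_cases s <;> norm_num <;> omega
      · norm_num; omega
      · have hro : (((7 : ℕ) : ℤ) ^ 8 - ((8 : ℕ) : ℤ) * ((5 * l : ℕ) : ℤ)) = 5764801 - 8 * (5 * (2 * (j : ℤ) + 1)) := by
          push_cast; omega
        rw [hro, hij, he, hm]
        exact RefBand.not_hullCell_hex27_A5_a8 (by omega) (by omega) hrin
    by_cases hp5 : 6917763 ≤ l ∧ l ≤ 48424327
    · refine ⟨9, fun s hs => ?_, ?_, ?_⟩
      · interval_cases s <;> norm_num <;> omega
      · norm_num; omega
      · have hro : (((7 : ℕ) : ℤ) ^ 9 - ((9 : ℕ) : ℤ) * ((5 * l : ℕ) : ℤ)) = 40353607 - 9 * (5 * (2 * (j : ℤ) + 1)) := by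
          push_cast; omega
        rw [hro, hij, he, hm]
        exact RefBand.not_hullCell_hex27_A5_a9 (by omega) (by omega) hrin
    by_cases hp6 : 48424329 ≤ l ∧ l ≤ 338970297
    · refine ⟨10, fun s hs => ?_, ?_, ?_⟩
      · interval_cases s <;> norm_num <;> omega
      · norm_num; omega
      · have hro : (((7 : ℕ) : ℤ) ^ 10 - ((10 : ℕ) : ℤ) * ((5 * l : ℕ) : ℤ)) = 282475249 - 10 * (5 * (2 * (j : ℤ) + 1)) := by
          push_cast; omega
        rw [hro, hij, he, hm]
        exact RefBand.not_hullCell_hex27_A5_a10 (by omega) (by omega) hrin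
    by_cases hp7 : 338970299 ≤ l ∧ l ≤ 2372792091
    · refine ⟨11, fun s hs => ?_, ?_, ?_⟩
      · interval_cases s <;> norm_num <;> omega
      · norm_num; omega
      · have hro : (((7 : ℕ) : ℤ) ^ 11 - ((11 : ℕ) : ℤ) * ((5 * l : ℕ) : ℤ)) = 1977326743 - 11 * (5 * (2 * (j : ℤ) + 1)) := by
          push_cast; omega
        rw [hro, hij, he, hm]
        exact RefBand.not_hullCell_hex27_A5_a11 (by omega) (by omega) hrin
    by_cases hp8 : 2372792093 ≤ l ∧ l ≤ 14533351499
    · refine ⟨12, fun s hs => ?_, ?_, ?_⟩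
      · interval_cases s <;> norm_num <;> omega
      · norm_num; omega
      · have hro : (((7 : ℕ) : ℤ) ^ 12 - ((12 : ℕ) : ℤ) * ((5 * l : ℕ) : ℤ)) = 13841287201 - 12 * (5 * (2 * (j : ℤ) + 1)) := by
          push_cast; omega
        rw [hro, hij, he, hm]
        exact RefBand.not_hullCell_hex27_A5_a12 (by omega) (by omega) hrin
    -- no level is left: the pieces cover the whole band
    exfalso; omega
  · have hrin : (6 : ℤ) * (((((10 * l) / ((7 : ℕ) - 1) + 1 : ℕ) : ℤ))) ≤ 10 * (2 * (j : ℤ) + 1) + 6 := by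
      have h0 : ((7 : ℕ) - 1) * ((10 * l) / ((7 : ℕ) - 1)) ≤ 10 * l := Nat.mul_div_le _ _
      have h1 : (6 : ℤ) * ((((10 * l) / ((7 : ℕ) - 1) : ℕ) : ℤ)) ≤ ((10 * l : ℕ) : ℤ) := by exact_mod_cast h0
      push_cast at h1 ⊢; omega
    have he : ((10 * l : ℕ) : ℤ) = 10 * (2 * (j : ℤ) + 1) := by push_cast; omega
    have hm : ((10 * 27 : ℕ) : ℤ) = 270 := by norm_num
    by_cases hp0 : 481 ≤ l ∧ l ≤ 1439
    · refine ⟨4, fun s hs => ?_, ?_, ?_⟩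
      · interval_cases s <;> norm_num <;> omega
      · norm_num; omega
      · have hro : (((7 : ℕ) : ℤ) ^ 4 - ((4 : ℕ) : ℤ) * ((10 * l : ℕ) : ℤ)) = 2401 - 4 * (10 * (2 * (j : ℤ) + 1)) := by
          push_cast; omega
        rw [hro, hij, he, hm]
        exact RefBand.not_hullCell_hex27_A10_a4 (by omega) (by omega) hrin
    by_cases hp1 : 1441 ≤ l ∧ l ≤ 10083
    · refine ⟨5, fun s hs => ?_, ?_, ?_⟩
      · interval_cases s <;> norm_num <;> omega
      · norm_num; omega
      · have hro : (((7 : ℕ) : ℤ) ^ 5 - ((5 : ℕ) : ℤ) * ((10 * l : ℕ) : ℤ)) = 16807 - 5 * (10 * (2 * (j : ℤ) + 1)) := by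
          push_cast; omega
        rw [hro, hij, he, hm]
        exact RefBand.not_hullCell_hex27_A10_a5 (by omega) (by omega) hrin
    by_cases hp2 : 10085 ≤ l ∧ l ≤ 70589
    · refine ⟨6, fun s hs => ?_, ?_, ?_⟩
      · interval_cases s <;> norm_num <;> omega
      · norm_num; omega
      · have hro : (((7 : ℕ) : ℤ) ^ 6 - ((6 : ℕ) : ℤ) * ((10 * l : ℕ) : ℤ)) = 117649 - 6 * (10 * (2 * (j : ℤ) + 1)) := by
          push_cast; omega
        rw [hro, hij, he, hm]
        exact RefBand.not_hullCell_hex27_A10_a6 (by omega) (by omega) hrin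
    by_cases hp3 : 70591 ≤ l ∧ l ≤ 494125
    · refine ⟨7, fun s hs => ?_, ?_, ?_⟩
      · interval_cases s <;> norm_num <;> omega
      · norm_num; omega
      · have hro : (((7 : ℕ) : ℤ) ^ 7 - ((7 : ℕ) : ℤ) * ((10 * l : ℕ) : ℤ)) = 823543 - 7 * (10 * (2 * (j : ℤ) + 1)) := by
          push_cast; omega
        rw [hro, hij, he, hm]
        exact RefBand.not_hullCell_hex27_A10_a7 (by omega) (by omega) hrin
    by_cases hp4 : 494127 ≤ l ∧ l ≤ 3458879
    · refine ⟨8, fun s hs => ?_, ?_, ?_⟩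
      · interval_cases s <;> norm_num <;> omega
      · norm_num; omega
      · have hro : (((7 : ℕ) : ℤ) ^ 8 - ((8 : ℕ) : ℤ) * ((10 * l : ℕ) : ℤ)) = 5764801 - 8 * (10 * (2 * (j : ℤ) + 1)) := by
          push_cast; omega
        rw [hro, hij, he, hm]
        exact RefBand.not_hullCell_hex27_A10_a8 (by omega) (by omega) hrin
    by_cases hp5 : 3458881 ≤ l ∧ l ≤ 24212163
    · refine ⟨9, fun s hs => ?_, ?_, ?_⟩
      · interval_cases s <;> norm_num <;> omega
      · norm_num; omega
      · have hro : (((7 : ℕ) : ℤ) ^ 9 - ((9 : ℕ) : ℤ) * ((10 * l : ℕ) : ℤ)) = 40353607 - 9 * (10 * (2 * (j : ℤ) + 1)) := by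
          push_cast; omega
        rw [hro, hij, he, hm]
        exact RefBand.not_hullCell_hex27_A10_a9 (by omega) (by omega) hrin
    by_cases hp6 : 24212165 ≤ l ∧ l ≤ 169485149
    · refine ⟨10, fun s hs => ?_, ?_, ?_⟩
      · interval_cases s <;> norm_num <;> omega
      · norm_num; omega
      · have hro : (((7 : ℕ) : ℤ) ^ 10 - ((10 : ℕ) : ℤ) * ((10 * l : ℕ) : ℤ)) = 282475249 - 10 * (10 * (2 * (j : ℤ) + 1)) := by
          push_cast; omega
        rw [hro, hij, he, hm]
        exact RefBand.not_hullCell_hex27_A10_a10 (by omega) (by omega) hrin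
    by_cases hp7 : 169485151 ≤ l ∧ l ≤ 1186396045
    · refine ⟨11, fun s hs => ?_, ?_, ?_⟩
      · interval_cases s <;> norm_num <;> omega
      · norm_num; omega
      · have hro : (((7 : ℕ) : ℤ) ^ 11 - ((11 : ℕ) : ℤ) * ((10 * l : ℕ) : ℤ)) = 1977326743 - 11 * (10 * (2 * (j : ℤ) + 1)) := by
          push_cast; omega
        rw [hro, hij, he, hm]
        exact RefBand.not_hullCell_hex27_A10_a11 (by omega) (by omega) hrin
    by_cases hp8 : 1186396047 ≤ l ∧ l ≤ 8304772319
    · refine ⟨12, fun s hs => ?_, ?_, ?_⟩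
      · interval_cases s <;> norm_num <;> omega
      · norm_num; omega
      · have hro : (((7 : ℕ) : ℤ) ^ 12 - ((12 : ℕ) : ℤ) * ((10 * l : ℕ) : ℤ)) = 13841287201 - 12 * (10 * (2 * (j : ℤ) + 1)) := by
          push_cast; omega
        rw [hro, hij, he, hm]
        exact RefBand.not_hullCell_hex27_A10_a12 (by omega) (by omega) hrin
    by_cases hp9 : 8304772321 ≤ l ∧ l ≤ 14533351499
    · refine ⟨13, fun s hs => ?_, ?_, ?_⟩
      · interval_cases s <;> norm_num <;> omega
      · norm_num; omega
      · have hro : (((7 : ℕ) : ℤ) ^ 13 - ((13 : ℕ) : ℤ) * ((10 * l : ℕ) : ℤ)) = 96889010407 - 13 * (10 * (2 * (j : ℤ) + 1)) := by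
          push_cast; omega
        rw [hro, hij, he, hm]
        exact RefBand.not_hullCell_hex27_A10_a13 (by omega) (by omega) hrin
    -- no level is left: the pieces cover the whole band
    exfalso; omega

end Summit.ABC.IUTFork.Conditional

end
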